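import Summits.QuantumFields.YangMills.Theorems.UnitScaleTiltProp7GreenPiBlockDecayOfLetters
import HarnessLib

/-!
# Route `UnitScaleTilt`, crux K1 «MinimiserStabilityRegPr» (stmt-QuantumFields-19200), EX rows (7) `hCk` ∕ (8) `h137kΔ` — **(F) THE `Δ^η + T_J`-SLOT GREEN ROWS:
# BLOCK-SUPPORTED SOURCE ⟹ DECAYING VALUES OF `G_S = (Δ^η + T_J + DR_SD* + Q_k†aQ_k)⁻¹` AND SMALL DECAYING VALUES OF `G_S − G₀`** — the `hGblk`∕`hΔb` letters AT THE
# UN-PROJECTED J-SLOT `S_J := DeltaEtaSlot + T_J` of S47's rows (7)(8), inputs of px10's slot-generic cone ✓`Prop7KinvSlotOfCone.kinvRow_slot_family_of_cone` and of the C∕137-doors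
# (✓`Prop7KernelCDoorOfKinvEntry`, ✓`Prop7Kernel137DoorOfKinvEntry`); ★p1 g28 CHAIR LOCATE №45.  [Balaban1985BackgroundPropagators] Thm 3.12 (3.42) for the J-slot propagator,
# [Balaban1985Variational] (110)–(111).

Cell `ym3-torus` (HUMAN RULING D-0037; rung R3 = SU(2) YM₃ on T³ — NOT d = 4, NOT infinite volume, NOT a mass gap, NOT Clay).  Fleet lead ∕ chair seat `ym-ust-19200-p1` (gen 28).
THEOREMS ONLY (0 `def`, 0 `sorry`); `--supports stmt-QuantumFields-19200 --as helper`; count-neutral.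

THE MATHEMATICS (D2∕D4-LITE: ONE perturbation word, VALUE currency only).  The slot enters `Δ_a` affinely (✓`laplaceA_sub_laplaceA`): `Δ_a[S]u − Δ_a[η]u = T_J u`.  On the two classes,
for `u := G_S f`: `Δ_a[η]u = f − T_J u`, so **`u = G₀ f − G₀(T_J u)`** (✓`GT_laplaceA`, ✓`laplaceA_GT`).  With the WEIGHTED letters about the source block `z` at rate `δ` — `hGw`
(N4-weighted values of `G₀`, D2's text VERBATIM) and `hTw` (E1's text VERBATIM: the weighted value row of `T_J`, px19 ✓`Prop7TJWeightedRowsOfUnweighted.hTw_of_supRow`) — the one-variable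
fixpoint for `N_V := max_b e^{δ·dc(B b₋, z)}|u(b)|` reads `N_V ≤ BV·s + BV·CT·N_V`; in the window `BV·CT ≤ ½`: `N_V ≤ 2BV·s`, and `u − G₀f = −G₀(T_J u)` has weighted size `≤ BV·CT·2BV·s`.

WHAT IS PROVED (ns `…Theorems.Prop7GreenEtaTJBlockDecayOfLetters`; member `F n K`, `h : n ≤ K`, weights `c₀ cB > 0`, coupling `a`, abstract `TJ : GaugeField → (BondL2K →ₗ BondL2K)`).
* §1 ★ `GT_etaTJ_eq_two_terms` — `G_S f = G₀ f − G₀(T_J(G_S f))` on `PosOnto(η) ∧ PosOnto(S)`.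
* §2 ★★★ **`blockDecay_rows_GTetaTJ_of_letters`** — weighted letters `hGw hTw` at a rate `δ` about `z`, window `BV·CT ≤ ½`: for `X` supported on the bonds of block `z` with `‖X b‖ ≤ s`,
  `‖toL2⁻¹(G_S(toL2 X)) bd‖ ≤ 2BV·s·e^{−δ·dc(B bd₋, z)}` AND `‖toL2⁻¹((G_S − G₀)(toL2 X)) bd‖ ≤ (2·BV·BV·CT)·s·e^{−δ·dc(B bd₋, z)}`.
* §3 ★★★ **`hGblk_etaTJ_of_letters`** (the H∕C-doors' `hGblk` binder text: `X z hXz s hs hX bd`, `s * CG * e^{−δ·tdist}`, `CG := 2BV`) and ★★★ **`hDelta_etaTJ_of_letters`** (B′'s `hΔb` binder text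
  VERBATIM at `Δx := DeltaEtaSlot + TJ`: `s * κ * e^{−δ·tdist}`, `κ := 2·BV·BV·CT` — `O(α)` since `CT = O(α)`), letters `∀ z`.
HYP-SAT (★★OWNER RULING №42).  `hGw` ⟸ px16 ✓p768545 §3 ∕ ✓`…OneFormGreenBlockSupFamily` (as in D3∕GΠ-PKG); `hTw` ⟸ px19 ✓p774572 `hTw_of_supRow` ⟸ `hHcol ∧ hC157` (LOCATE №27: the τ∕T rows follow
`h133`); `PosOnto(S)` ⟸ ✓p767766 §1 `coercive_laplaceA_add_of_curvedTarget_of_lift` ∘ ✓`posOnto_of_coercive` in the α-window; the window `BV·CT ≤ ½` is an α-window (`CT = k·e^{δ}`,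
`k = O(α)`).  Schemas force only nonneg constants at `Y = 0` — non-vacuous; no `Prop` placeholder.
HONEST SCOPE.  Algebra + a finite-dimensional weighted fixpoint over displayed letters; nothing of `hKinv(S_J)`, rows (7)(8), the other EX rows, EX or the crux is proved here;
the Yang–Mills mass gap is NOT proved.

References: T. Bałaban, CMP **99** (1985) 389–434 [Balaban1985BackgroundPropagators] ((3.26)–(3.27) p.395, (3.42) p.397, Thm 3.12 pp.422–423, (3.128)–(3.131) pp.421–422);
CMP **102** (1985) 277–309 [Balaban1985Variational] ((110)–(111) p.294, (137) p.298).
-/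

set_option autoImplicit false

noncomputable section

open scoped Matrix.Norms.L2Operator BigOperators InnerProductSpace ComplexConjugate

namespace Summit.QuantumFields.YangMills.Theorems.Prop7GreenEtaTJBlockDecayOfLetters

open Literature.MathematicalPhysics.QuantumFieldTheory.Balaban1983to89
open Literature.MathematicalPhysics.QuantumFieldTheory.Balaban1983to89.T3ContinuumYM3Torus
open T3PrintedRegularMinimiser (RegPr)
open B5Eq118OneStroke (iterBlockOf)
open B9Eq311L2Pairing (WL2)
open B11Eq103H1Complex (SiteL2K BondL2K)
open Summit.QuantumFields.YangMills.Theorems.Prop7SectET3Transport (periodsT3)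
open Summit.QuantumFields.YangMills.Theorems.Prop7SectET3HilbertLetters (W₂ toL2)
open Summit.QuantumFields.YangMills.Theorems.Prop7SectET3WilsonHessian (DeltaEtaSlot)
open Summit.QuantumFields.YangMills.Theorems.Prop7SectET3CurvedPropagators (laplaceA PosOnto GT GT_laplaceA laplaceA_GT)
open Summit.QuantumFields.YangMills.Theorems.Prop7SectET3OpsT3HilbertRows (laplaceA_sub_laplaceA)

variable {F : T3Family} {n K : ℕ} {h : n ≤ K} {c₀ cB a : ℝ} [Fact (0 < c₀)] [Fact (0 < cB)]
  (TJ : GaugeField (F.P K) 0 (Matrix.specialUnitaryGroup (Fin 2) ℂ) → (BondL2K ℂ 3 (periodsT3 F K) c₀ W₂ →ₗ[ℂ] BondL2K ℂ 3 (periodsT3 F K) c₀ W₂))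

/-! ## §1 The two-term identity at the slot `Δ^η + T_J` -/

/-- ★ **`G_S f = G₀ f − G₀(T_J(G_S f))` ON THE TWO CLASSES** (`S = Δ^η + T_J`): `Δ_a[η](G_S f) = Δ_a[S](G_S f) − T_J(G_S f) = f − T_J(G_S f)` (✓`laplaceA_sub_laplaceA`, ✓`laplaceA_GT`),
then `G₀Δ_a[η] = 1` (✓`GT_laplaceA`). [cite: Balaban1985BackgroundPropagators, (3.26)–(3.27) p.395, (3.130) p.421; Balaban1985Variational, (110) p.294] -/
theorem GT_etaTJ_eq_two_terms {U₀ : GaugeField (F.P K) 0 (Matrix.specialUnitaryGroup (Fin 2) ℂ)}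
    (hp₀ : PosOnto F n K h c₀ cB a (DeltaEtaSlot F n K c₀) U₀) (hpS : PosOnto F n K h c₀ cB a (DeltaEtaSlot F n K c₀ + TJ) U₀)
    (f : BondL2K ℂ 3 (periodsT3 F K) c₀ W₂) :
    GT F n K h c₀ cB a (DeltaEtaSlot F n K c₀ + TJ) U₀ f
      = GT F n K h c₀ cB a (DeltaEtaSlot F n K c₀) U₀ f
        - GT F n K h c₀ cB a (DeltaEtaSlot F n K c₀) U₀ (TJ U₀ (GT F n K h c₀ cB a (DeltaEtaSlot F n K c₀ + TJ) U₀ f)) := by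
  have hsub := laplaceA_sub_laplaceA (h := h) (cB := cB) (a := a) (Δ0x := DeltaEtaSlot F n K c₀ + TJ) (Δπx := DeltaEtaSlot F n K c₀) U₀
  have hS : laplaceA F n K h c₀ cB a (DeltaEtaSlot F n K c₀) U₀ (GT F n K h c₀ cB a (DeltaEtaSlot F n K c₀ + TJ) U₀ f)
      = f - TJ U₀ (GT F n K h c₀ cB a (DeltaEtaSlot F n K c₀ + TJ) U₀ f) := by
    have e := LinearMap.congr_fun hsub (GT F n K h c₀ cB a (DeltaEtaSlot F n K c₀ + TJ) U₀ f)
    rw [LinearMap.sub_apply, LinearMap.sub_apply, laplaceA_GT hpS, Pi.add_apply, LinearMap.add_apply, add_sub_cancel_left] at e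
    -- `e : f − Δ_a[η]u = T_J u`
    rw [← sub_sub_cancel f (laplaceA F n K h c₀ cB a (DeltaEtaSlot F n K c₀) U₀ (GT F n K h c₀ cB a (DeltaEtaSlot F n K c₀ + TJ) U₀ f)), e]
  conv_lhs => rw [← GT_laplaceA hp₀ (GT F n K h c₀ cB a (DeltaEtaSlot F n K c₀ + TJ) U₀ f), hS, map_sub]

/-! ## §2 The weighted one-variable bootstrap -/

/-- ★★★ **BLOCK-SUPPORTED SOURCE ⟹ DECAYING VALUES OF `G_S` AND SMALL DECAYING VALUES OF `G_S − G₀`** (`S = Δ^η + T_J`): on the two classes, with the weighted letters about `z` at rate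
`δ` — `hGw` (values of `G₀`, constant `BV`) and `hTw` (values of `T_J`, constant `CT`) — and the window `BV·CT ≤ ½`: for every `X` supported on the bonds of block `z` with `‖X b‖ ≤ s`,
`‖toL2⁻¹(G_S(toL2 X)) bd‖ ≤ 2BV·s·e^{−δ·dc(B bd₋, z)}` and `‖toL2⁻¹((G_S − G₀)(toL2 X)) bd‖ ≤ (2·BV·BV·CT)·s·e^{−δ·dc(B bd₋, z)}`.
[cite: Balaban1985BackgroundPropagators, (3.42) p.397, Thm 3.12 pp.422–423, (3.130)–(3.131) pp.421–422; Balaban1985Variational, (110)–(111) p.294] -/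
theorem blockDecay_rows_GTetaTJ_of_letters {δ : ℝ} (U₀ : GaugeField (F.P K) 0 (Matrix.specialUnitaryGroup (Fin 2) ℂ))
    (hp₀ : PosOnto F n K h c₀ cB a (DeltaEtaSlot F n K c₀) U₀) (hpS : PosOnto F n K h c₀ cB a (DeltaEtaSlot F n K c₀ + TJ) U₀)
    (z : Site (F.P K) (K - n)) {BV CT : ℝ} (hBV : 0 ≤ BV) (hCT : 0 ≤ CT)
    (hGw : ∀ (Y : PBond (F.P K) 0 → Matrix (Fin 2) (Fin 2) ℂ) (m : ℝ), 0 ≤ m →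
      (∀ b, ‖Y b‖ ≤ m * Real.exp (-(δ * (Site.tdist (iterBlockOf (K - n) b.src) z : ℝ)))) →
      ∀ bd, ‖(toL2 F K c₀).symm (GT F n K h c₀ cB a (DeltaEtaSlot F n K c₀) U₀ (toL2 F K c₀ Y)) bd‖
        ≤ BV * m * Real.exp (-(δ * (Site.tdist (iterBlockOf (K - n) bd.src) z : ℝ))))
    (hTw : ∀ (Y : PBond (F.P K) 0 → Matrix (Fin 2) (Fin 2) ℂ) (m : ℝ), 0 ≤ m →
      (∀ b, ‖Y b‖ ≤ m * Real.exp (-(δ * (Site.tdist (iterBlockOf (K - n) b.src) z : ℝ)))) →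
      ∀ bd, ‖(toL2 F K c₀).symm (TJ U₀ (toL2 F K c₀ Y)) bd‖ ≤ CT * m * Real.exp (-(δ * (Site.tdist (iterBlockOf (K - n) bd.src) z : ℝ))))
    (hwin : BV * CT ≤ 1 / 2)
    (X : PBond (F.P K) 0 → Matrix (Fin 2) (Fin 2) ℂ) (hXz : ∀ b, X b ≠ 0 → iterBlockOf (K - n) b.src = z) {s : ℝ} (hs : 0 ≤ s) (hX : ∀ b, ‖X b‖ ≤ s) :
    (∀ bd, ‖(toL2 F K c₀).symm (GT F n K h c₀ cB a (DeltaEtaSlot F n K c₀ + TJ) U₀ (toL2 F K c₀ X)) bd‖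
        ≤ 2 * BV * s * Real.exp (-(δ * (Site.tdist (iterBlockOf (K - n) bd.src) z : ℝ)))) ∧
    (∀ bd, ‖(toL2 F K c₀).symm ((GT F n K h c₀ cB a (DeltaEtaSlot F n K c₀ + TJ) U₀ - GT F n K h c₀ cB a (DeltaEtaSlot F n K c₀) U₀) (toL2 F K c₀ X)) bd‖
        ≤ (2 * BV * BV * CT) * s * Real.exp (-(δ * (Site.tdist (iterBlockOf (K - n) bd.src) z : ℝ)))) := by
  classical
  -- opaque Agmon weights `w(b) = e^{+δ·dc(B b₋, z)}`
  obtain ⟨wB, hwBd⟩ : ∃ w : PBond (F.P K) 0 → ℝ, ∀ b, w b = Real.exp (δ * (Site.tdist (iterBlockOf (K - n) b.src) z : ℝ)) := ⟨_, fun _ => rfl⟩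
  have hwB : ∀ b, wB b * Real.exp (-(δ * (Site.tdist (iterBlockOf (K - n) b.src) z : ℝ))) = 1 := fun b => by
    rw [hwBd, ← Real.exp_add, add_neg_cancel, Real.exp_zero]
  have hwBpos : ∀ b, 0 < wB b := fun b => by rw [hwBd]; exact Real.exp_pos _
  have decayB : ∀ (U : PBond (F.P K) 0 → Matrix (Fin 2) (Fin 2) ℂ) (M : ℝ), (∀ b, wB b * ‖U b‖ ≤ M) →
      ∀ b, ‖U b‖ ≤ M * Real.exp (-(δ * (Site.tdist (iterBlockOf (K - n) b.src) z : ℝ))) := by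
    intro U M hM b
    calc ‖U b‖ = (wB b * ‖U b‖) * Real.exp (-(δ * (Site.tdist (iterBlockOf (K - n) b.src) z : ℝ))) := by rw [mul_comm (wB b), mul_assoc, hwB b, mul_one]
      _ ≤ M * Real.exp (-(δ * (Site.tdist (iterBlockOf (K - n) b.src) z : ℝ))) := mul_le_mul_of_nonneg_right (hM b) (Real.exp_pos _).le
  -- the objects (opaque names)
  obtain ⟨u, hud⟩ : ∃ t : BondL2K ℂ 3 (periodsT3 F K) c₀ W₂, t = GT F n K h c₀ cB a (DeltaEtaSlot F n K c₀ + TJ) U₀ (toL2 F K c₀ X) := ⟨_, rfl⟩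
  obtain ⟨Uv, hUvd⟩ : ∃ t : PBond (F.P K) 0 → Matrix (Fin 2) (Fin 2) ℂ, t = (toL2 F K c₀).symm u := ⟨_, rfl⟩
  have hUveq : toL2 F K c₀ Uv = u := by rw [hUvd, LinearEquiv.apply_symm_apply]
  -- the identity `u = G₀X − G₀(T_J u)`
  have h2 : u = GT F n K h c₀ cB a (DeltaEtaSlot F n K c₀) U₀ (toL2 F K c₀ X)
      - GT F n K h c₀ cB a (DeltaEtaSlot F n K c₀) U₀ (TJ U₀ (toL2 F K c₀ Uv)) := by
    rw [hUveq, hud]; exact GT_etaTJ_eq_two_terms (h := h) (cB := cB) (a := a) TJ hp₀ hpS _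
  -- weighted maximiser
  haveI : Nonempty (PBond (F.P K) 0) := ⟨⟨Classical.arbitrary _, 0⟩⟩
  obtain ⟨b₀, -, hb₀⟩ := Finset.exists_max_image Finset.univ (fun b => wB b * ‖Uv b‖) Finset.univ_nonempty
  obtain ⟨NV, hNVd⟩ : ∃ t : ℝ, t = wB b₀ * ‖Uv b₀‖ := ⟨_, rfl⟩
  have hNV0 : 0 ≤ NV := by rw [hNVd]; exact mul_nonneg (hwBpos b₀).le (norm_nonneg _)
  have hUb : ∀ b, ‖Uv b‖ ≤ NV * Real.exp (-(δ * (Site.tdist (iterBlockOf (K - n) b.src) z : ℝ))) :=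
    decayB _ NV (fun b => by rw [hNVd]; exact hb₀ b (Finset.mem_univ b))
  -- the block-supported source is a weighted one
  have hXw : ∀ b, ‖X b‖ ≤ s * Real.exp (-(δ * (Site.tdist (iterBlockOf (K - n) b.src) z : ℝ))) := by
    intro b
    by_cases hb : X b = 0
    · rw [hb, norm_zero]; positivity
    · have h0 : (Site.tdist z z : ℝ) = 0 := by exact_mod_cast (by simp [Site.tdist] : Site.tdist z z = 0)
      rw [hXz b hb, h0, mul_zero, neg_zero, Real.exp_zero, mul_one]; exact hX b
  -- the three readers: `G₀X`, `T_J u`, `G₀(T_J u)`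
  have hV₀ := hGw X s hs hXw
  have hT : ∀ bd, ‖(toL2 F K c₀).symm (TJ U₀ (toL2 F K c₀ Uv)) bd‖ ≤ CT * NV * Real.exp (-(δ * (Site.tdist (iterBlockOf (K - n) bd.src) z : ℝ))) :=
    hTw Uv NV hNV0 hUb
  obtain ⟨Tv, hTvd⟩ : ∃ t : PBond (F.P K) 0 → Matrix (Fin 2) (Fin 2) ℂ, t = (toL2 F K c₀).symm (TJ U₀ (toL2 F K c₀ Uv)) := ⟨_, rfl⟩
  have hTveq : toL2 F K c₀ Tv = TJ U₀ (toL2 F K c₀ Uv) := by rw [hTvd, LinearEquiv.apply_symm_apply]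
  have hTv : ∀ b, ‖Tv b‖ ≤ CT * NV * Real.exp (-(δ * (Site.tdist (iterBlockOf (K - n) b.src) z : ℝ))) := fun b => by rw [hTvd]; exact hT b
  have hCTNV : 0 ≤ CT * NV := mul_nonneg hCT hNV0
  have hV₁ : ∀ bd, ‖(toL2 F K c₀).symm (GT F n K h c₀ cB a (DeltaEtaSlot F n K c₀) U₀ (TJ U₀ (toL2 F K c₀ Uv))) bd‖
      ≤ BV * (CT * NV) * Real.exp (-(δ * (Site.tdist (iterBlockOf (K - n) bd.src) z : ℝ))) := fun bd => by
    rw [← hTveq]; exact hGw Tv (CT * NV) hCTNV hTv bd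
  -- pointwise: `‖u(b)‖ ≤ (BV·s + BV·CT·NV)·E(b)` and `‖(u − G₀X)(b)‖ ≤ BV·CT·NV·E(b)`
  have hpt : ∀ bd, ‖Uv bd‖ ≤ (BV * s + BV * CT * NV) * Real.exp (-(δ * (Site.tdist (iterBlockOf (K - n) bd.src) z : ℝ))) := by
    intro bd
    have e : Uv bd = (toL2 F K c₀).symm (GT F n K h c₀ cB a (DeltaEtaSlot F n K c₀) U₀ (toL2 F K c₀ X)) bd
        - (toL2 F K c₀).symm (GT F n K h c₀ cB a (DeltaEtaSlot F n K c₀) U₀ (TJ U₀ (toL2 F K c₀ Uv))) bd := by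
      conv_lhs => rw [hUvd, h2]
      rw [map_sub, Pi.sub_apply]
    rw [e]
    calc _ ≤ BV * s * Real.exp (-(δ * (Site.tdist (iterBlockOf (K - n) bd.src) z : ℝ)))
          + BV * (CT * NV) * Real.exp (-(δ * (Site.tdist (iterBlockOf (K - n) bd.src) z : ℝ))) := (norm_sub_le _ _).trans (add_le_add (hV₀ bd) (hV₁ bd))
      _ = _ := by ring
  -- the fixpoint at the maximiser
  have hNVle : NV ≤ BV * s + BV * CT * NV := by
    calc NV = wB b₀ * ‖Uv b₀‖ := hNVd
      _ ≤ wB b₀ * ((BV * s + BV * CT * NV) * Real.exp (-(δ * (Site.tdist (iterBlockOf (K - n) b₀.src) z : ℝ)))) :=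
          mul_le_mul_of_nonneg_left (hpt b₀) (hwBpos b₀).le
      _ = (BV * s + BV * CT * NV) * (wB b₀ * Real.exp (-(δ * (Site.tdist (iterBlockOf (K - n) b₀.src) z : ℝ)))) := by ring
      _ = BV * s + BV * CT * NV := by rw [hwB b₀, mul_one]
  have hfix : NV ≤ 2 * BV * s := by
    have h1 : BV * CT * NV ≤ 1 / 2 * NV := mul_le_mul_of_nonneg_right hwin hNV0
    nlinarith [hNVle, h1, hNV0, mul_nonneg hBV hs]
  have hE : ∀ bd : PBond (F.P K) 0, 0 ≤ Real.exp (-(δ * (Site.tdist (iterBlockOf (K - n) bd.src) z : ℝ))) := fun _ => (Real.exp_pos _).le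
  refine ⟨fun bd => ?_, fun bd => ?_⟩
  · -- values of `G_S X`
    rw [← hud, ← hUvd]
    calc ‖Uv bd‖ ≤ NV * Real.exp (-(δ * (Site.tdist (iterBlockOf (K - n) bd.src) z : ℝ))) := hUb bd
      _ ≤ (2 * BV * s) * Real.exp (-(δ * (Site.tdist (iterBlockOf (K - n) bd.src) z : ℝ))) := mul_le_mul_of_nonneg_right hfix (hE bd)
      _ = _ := by ring
  · -- values of `(G_S − G₀)X = −G₀(T_J u)`
    have e : (toL2 F K c₀).symm ((GT F n K h c₀ cB a (DeltaEtaSlot F n K c₀ + TJ) U₀ - GT F n K h c₀ cB a (DeltaEtaSlot F n K c₀) U₀) (toL2 F K c₀ X)) bd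
        = -((toL2 F K c₀).symm (GT F n K h c₀ cB a (DeltaEtaSlot F n K c₀) U₀ (TJ U₀ (toL2 F K c₀ Uv))) bd) := by
      rw [LinearMap.sub_apply, ← hud, h2, sub_sub_cancel_left, map_neg, Pi.neg_apply]
    rw [e, norm_neg]
    calc _ ≤ BV * (CT * NV) * Real.exp (-(δ * (Site.tdist (iterBlockOf (K - n) bd.src) z : ℝ))) := hV₁ bd
      _ ≤ BV * (CT * (2 * BV * s)) * Real.exp (-(δ * (Site.tdist (iterBlockOf (K - n) bd.src) z : ℝ))) := by gcongr
      _ = _ := by ring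

/-! ## §3 The doors' binder texts: `hGblk(S_J)` and the cone's `hΔb(S_J)` -/

/-- ★★★ **`hGblk` AT THE SLOT `Δ^η + T_J` IN THE H∕C-DOORS' BINDER TEXT** (`X z hXz s hs hX bd`, `s * CG * e^{−δ·tdist}`, `CG := 2BV`), weighted letters `∀ z`.
[cite: Balaban1985BackgroundPropagators, Thm 3.12 (3.42) pp.422–423; Balaban1985Variational, (110) p.294] -/
theorem hGblk_etaTJ_of_letters {δ : ℝ} (U₀ : GaugeField (F.P K) 0 (Matrix.specialUnitaryGroup (Fin 2) ℂ))
    (hp₀ : PosOnto F n K h c₀ cB a (DeltaEtaSlot F n K c₀) U₀) (hpS : PosOnto F n K h c₀ cB a (DeltaEtaSlot F n K c₀ + TJ) U₀)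
    {BV CT : ℝ} (hBV : 0 ≤ BV) (hCT : 0 ≤ CT)
    (hGw : ∀ (z : Site (F.P K) (K - n)) (Y : PBond (F.P K) 0 → Matrix (Fin 2) (Fin 2) ℂ) (m : ℝ), 0 ≤ m →
      (∀ b, ‖Y b‖ ≤ m * Real.exp (-(δ * (Site.tdist (iterBlockOf (K - n) b.src) z : ℝ)))) →
      ∀ bd, ‖(toL2 F K c₀).symm (GT F n K h c₀ cB a (DeltaEtaSlot F n K c₀) U₀ (toL2 F K c₀ Y)) bd‖
        ≤ BV * m * Real.exp (-(δ * (Site.tdist (iterBlockOf (K - n) bd.src) z : ℝ))))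
    (hTw : ∀ (z : Site (F.P K) (K - n)) (Y : PBond (F.P K) 0 → Matrix (Fin 2) (Fin 2) ℂ) (m : ℝ), 0 ≤ m →
      (∀ b, ‖Y b‖ ≤ m * Real.exp (-(δ * (Site.tdist (iterBlockOf (K - n) b.src) z : ℝ)))) →
      ∀ bd, ‖(toL2 F K c₀).symm (TJ U₀ (toL2 F K c₀ Y)) bd‖ ≤ CT * m * Real.exp (-(δ * (Site.tdist (iterBlockOf (K - n) bd.src) z : ℝ))))
    (hwin : BV * CT ≤ 1 / 2) :
    ∀ (X : PBond (F.P K) 0 → Matrix (Fin 2) (Fin 2) ℂ) (z : Site (F.P K) (K - n)), (∀ b, X b ≠ 0 → iterBlockOf (K - n) b.src = z) →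
      ∀ s : ℝ, 0 ≤ s → (∀ b, ‖X b‖ ≤ s) →
        ∀ bd : PBond (F.P K) 0, ‖(toL2 F K c₀).symm (GT F n K h c₀ cB a (DeltaEtaSlot F n K c₀ + TJ) U₀ (toL2 F K c₀ X)) bd‖
          ≤ s * (2 * BV) * Real.exp (-(δ * (Site.tdist (P := F.P K) (iterBlockOf (K - n) bd.src) z : ℝ))) := by
  intro X z hXz s hs hX bd
  have h1 := (blockDecay_rows_GTetaTJ_of_letters TJ U₀ hp₀ hpS z hBV hCT (hGw z) (hTw z) hwin X hXz hs hX).1 bd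
  calc _ ≤ _ := h1
    _ = _ := by ring

/-- ★★★ **THE CONE's `hΔb` AT THE SLOT `Δ^η + T_J`** — px10's ✓`kinvRow_slot_of_kinvRow_eta_of_cone` `hΔb` binder text VERBATIM at `Δx := DeltaEtaSlot + TJ`: for block-supported `X`,
`‖toL2⁻¹((G_S − G₀)(toL2 X)) bd‖ ≤ s·κ·e^{−δ·tdist}` with `κ := 2·BV·BV·CT` (`O(α)`), weighted letters `∀ z`.
[cite: Balaban1985BackgroundPropagators, (3.130)–(3.132) pp.421–422, Thm 3.12 p.423; Balaban1985Variational, (110)–(111) p.294] -/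
theorem hDelta_etaTJ_of_letters {δ : ℝ} (U₀ : GaugeField (F.P K) 0 (Matrix.specialUnitaryGroup (Fin 2) ℂ))
    (hp₀ : PosOnto F n K h c₀ cB a (DeltaEtaSlot F n K c₀) U₀) (hpS : PosOnto F n K h c₀ cB a (DeltaEtaSlot F n K c₀ + TJ) U₀)
    {BV CT : ℝ} (hBV : 0 ≤ BV) (hCT : 0 ≤ CT)
    (hGw : ∀ (z : Site (F.P K) (K - n)) (Y : PBond (F.P K) 0 → Matrix (Fin 2) (Fin 2) ℂ) (m : ℝ), 0 ≤ m →
      (∀ b, ‖Y b‖ ≤ m * Real.exp (-(δ * (Site.tdist (iterBlockOf (K - n) b.src) z : ℝ)))) →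
      ∀ bd, ‖(toL2 F K c₀).symm (GT F n K h c₀ cB a (DeltaEtaSlot F n K c₀) U₀ (toL2 F K c₀ Y)) bd‖
        ≤ BV * m * Real.exp (-(δ * (Site.tdist (iterBlockOf (K - n) bd.src) z : ℝ))))
    (hTw : ∀ (z : Site (F.P K) (K - n)) (Y : PBond (F.P K) 0 → Matrix (Fin 2) (Fin 2) ℂ) (m : ℝ), 0 ≤ m →
      (∀ b, ‖Y b‖ ≤ m * Real.exp (-(δ * (Site.tdist (iterBlockOf (K - n) b.src) z : ℝ)))) →
      ∀ bd, ‖(toL2 F K c₀).symm (TJ U₀ (toL2 F K c₀ Y)) bd‖ ≤ CT * m * Real.exp (-(δ * (Site.tdist (iterBlockOf (K - n) bd.src) z : ℝ))))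
    (hwin : BV * CT ≤ 1 / 2) :
    ∀ (X : PBond (F.P K) 0 → Matrix (Fin 2) (Fin 2) ℂ) (z : Site (F.P K) (K - n)), (∀ b, X b ≠ 0 → iterBlockOf (K - n) b.src = z) →
      ∀ s : ℝ, 0 ≤ s → (∀ b, ‖X b‖ ≤ s) →
        ∀ bd : PBond (F.P K) 0, ‖(toL2 F K c₀).symm ((GT F n K h c₀ cB a (DeltaEtaSlot F n K c₀ + TJ) U₀ - GT F n K h c₀ cB a (DeltaEtaSlot F n K c₀) U₀) (toL2 F K c₀ X)) bd‖
          ≤ s * (2 * BV * BV * CT) * Real.exp (-(δ * (Site.tdist (P := F.P K) (iterBlockOf (K - n) bd.src) z : ℝ))) := by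
  intro X z hXz s hs hX bd
  have h1 := (blockDecay_rows_GTetaTJ_of_letters TJ U₀ hp₀ hpS z hBV hCT (hGw z) (hTw z) hwin X hXz hs hX).2 bd
  calc _ ≤ _ := h1
    _ = _ := by ring

end Summit.QuantumFields.YangMills.Theorems.Prop7GreenEtaTJBlockDecayOfLetters

end
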